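import Literature.MathematicalPhysics.QuantumFieldTheory.ConformalBootstrap3D.PointKernelK34L505Data
import Literature.MathematicalPhysics.QuantumFieldTheory.ConformalBootstrap3D.PointKernelK34L505Segs
import Literature.MathematicalPhysics.QuantumFieldTheory.ConformalBootstrap3D.PointKernelParts

/-!
# K34L505 certificate, kernel part file P36: one-cell head segments 101, 102 in level ranges

The head cells whose kernel evaluation exceeds one `decide` are one-cell segments of `hsegsK34L505`; each is
checked by `PCert.hPartSideOK` (side conditions) and `PCert.hPartOK` per level range `[n_lo, n_lo + count)`
against an integer claim, the claims summing to `≥ 0` (`PointKernel.partsOK`); soundness is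
`PCert.hParts_sound` (`PointKernelParts`).  The part files are mutually independent (each imports only
the data file); the ranges of one cell may span several of them, and the per-cell conclusions
`hparts_i` / `hcell_i` of those cells are assembled in `PointKernelK34L505.lean`.
Estimated kernel time 248 s.
-/

set_option maxRecDepth 100000
set_option maxHeartbeats 0

namespace Literature.MathematicalPhysics.QuantumFieldTheory.ConformalBootstrap3D.PointKernelK34L505

open Literature.MathematicalPhysics.QuantumFieldTheory.ConformalBootstrap3D.PointKernel

/-- levels `[61, 65)` of segment 101: partial lower sum `≥` claim. [folklore] -/
theorem part_101_5 : certK34L505.hPartOK (PCert.segAt hsegsK34L505 101) JHK34L505 61 4 (232983223459745088985092306988890615) = true := by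
  decide +kernel

/-- one-cell segment 102 (row 6, cell `[14341/2048, 7171/1024]`, chord, `n_F = 64`,
6 level ranges): side conditions. [folklore] -/
theorem pside_102 : certK34L505.hPartSideOK (PCert.segAt hsegsK34L505 102) JHK34L505 = true := by
  decide +kernel

/-- its level ranges `(n_lo, count, claim)`. [folklore] -/
def partsK34L505_102 : List (ℕ × ℕ × ℤ) := [(0, 28, -21895867412574645218553623240561809344), (28, 12, 15639513423412124653753404266562289882), (40, 9, 4236138993641928107396023831244202656), (49, 7, 1347351650168312930080908396570766142), (56, 5, 466519486699637247474777906313077810), (61, 4, 206343858652642279848508839871472859)]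

/-- the ranges tile `[0, n_F]` and the claims sum to `≥ 0`. [folklore] -/
theorem pcov_102 : PointKernel.partsOK 64 partsK34L505_102 = true := by
  decide +kernel

/-- levels `[0, 28)` of segment 102: partial lower sum `≥` claim. [folklore] -/
theorem part_102_0 : certK34L505.hPartOK (PCert.segAt hsegsK34L505 102) JHK34L505 0 28 (-21895867412574645218553623240561809344) = true := by
  decide +kernel

/-- levels `[28, 40)` of segment 102: partial lower sum `≥` claim. [folklore] -/
theorem part_102_1 : certK34L505.hPartOK (PCert.segAt hsegsK34L505 102) JHK34L505 28 12 (15639513423412124653753404266562289882) = true := by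
  decide +kernel

/-- levels `[40, 49)` of segment 102: partial lower sum `≥` claim. [folklore] -/
theorem part_102_2 : certK34L505.hPartOK (PCert.segAt hsegsK34L505 102) JHK34L505 40 9 (4236138993641928107396023831244202656) = true := by
  decide +kernel

end Literature.MathematicalPhysics.QuantumFieldTheory.ConformalBootstrap3D.PointKernelK34L505
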